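import Mathlib.AlgebraicGeometry.Modules.Sheaf
import Mathlib.AlgebraicGeometry.Pullbacks
import Mathlib.CategoryTheory.Limits.Shapes.BinaryBiproducts
import Mathlib.CategoryTheory.Monoidal.Cartesian.Over
import Literature.AlgebraicGeometry.GroupSchemes.GrpObjShear
import HarnessLib

/-!
# The skeleton of Bosch–Lütkebohmert–Raynaud §4.2 Prop. 2: a module whose pull-backs along `m` and `pr₁`
# agree is pulled back from the unit section, `M ≅ π^* e^* M`

Layer `Literature/AlgebraicGeometry/GroupSchemes`; theorems + two isomorphism constructions, no named fact,
no instance, no notation. Cell `pub-hodge-ring2`, crux stmt-HodgeConjecture-26512, route BLR-absolute for the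
named fact `Motives.Mumford1970_cotangentSheaf_abelianVariety_free` (steps (ii)(iii) of the captain's step map):
research route conditional on HC_CM; not a corollary.

Bosch–Lütkebohmert–Raynaud, *Néron Models*, §4.2 Prop. 2 (p. 100): for a group scheme `p : G → S` with unit
section `e`, `Ω¹_{G/S} ≅ p^* e^* Ω¹_{G/S}`; the proof pulls the isomorphism `m^*Ω ≅ pr₁^*Ω` on `G ×_S G`
(the universal translation) back along the section `(e ∘ p, id) : G → G ×_S G`. This file isolates the two
FORMAL steps of that argument, for a group object `G` of `Over (Spec k)` (`k` any commutative ring, Mathlib's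
cartesian monoidal structure) and an ARBITRARY `𝒪_G`-module `M`:

* `isoOfIsIsoBiprodDesc` — pure category theory: if `(a, c) : X ⊞ Q ⟶ W` and `(b, c) : Y ⊞ Q ⟶ W` are both
  isomorphisms (same second component), then `X ≅ Y` (the composite `X ⊞ Q ≅ W ≅ Y ⊞ Q` fixes `inr`, so it is
  lower triangular with invertible corner). With `W = Ω¹_{G×G}`, `Q = pr₂^*Ω¹_G`, `X = m^*Ω¹_G`,
  `Y = pr₁^*Ω¹_G` and the product formula for `Ω¹` at the two limit fans `(pr₁, pr₂)`, `(m, pr₂)` of `G × G`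
  this is `m^*Ω¹_G ≅ pr₁^*Ω¹_G` (BLR: «`Ω¹_{G×G/G} = pr₁^*Ω¹` and the `G`-automorphism `(m, pr₂)`»).
* `isLimit_shearFan` — `(m, pr₂) : G ⊗ G ⟶ G`, `G` is a limit binary fan (the shear `(m, pr₂)` is an
  isomorphism, the tree's `GrpObjShear.isIso_lift_mul_snd`).
* `pullbackIsoPullbackUnitOfShear` / **`nonempty_iso_pullback_pullback_unit`** — for any `𝒪_G`-module `M`
  with `ψ : m^*M ≅ pr₁^*M`: `M ≅ (s ≫ m)^*M ≅ s^*m^*M ≅ s^*pr₁^*M ≅ (s ≫ pr₁)^*M = (π ≫ e)^*M ≅ π^*e^*M`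
  for the section `s = (1, id) : G ⟶ G ⊗ G` (`s ≫ m = 𝟙`, `s ≫ pr₁ = 1 = π ≫ e`), by Mathlib's
  pseudofunctoriality isomorphisms `Scheme.Modules.pullbackId / pullbackComp / pullbackCongr`.

Mathlib searched: `Scheme.Modules.pullback(Id|Comp|Congr)`, `CartesianMonoidalCategory.lift_fst/lift_snd`,
`Hom.mul_def`, `Hom.one_def` (the group structure on `X ⟶ G`), `biprod.*`; Mathlib has no statement of
BLR §4.2 Prop. 2 and no invariant differentials (rg `translation.*invariant`, `pullback.*unit.*Kaehler`: 0 hits).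
presearch: «Ω_G ≅ p^* e^* Ω group scheme invariant differential» → [cite: BoschLutkebohmertRaynaud1990, §4.2
Prop. 2] (locator from the tree's `Motives/AbelianVarietyCotangentSheafFree` docstring) + [corpus: book:gortz2023
p. 805] Görtz–Wedhorn II Prop. 27.15 («if `S` is the spectrum of a field, `Ω¹_{G/S}` is free»); galaxy
«invariant differential|translation invariant form» → Lange–Birkenhake §1.1 only (analytic); tree: the det-valued
shear cocycle for TOP forms `Motives/GroupSchemeTopFormFrame` (rational currency), not this module statement.

## References
* [BoschLutkebohmertRaynaud1990] S. Bosch, W. Lütkebohmert, M. Raynaud, *Néron Models*, Springer (1990), §4.2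
  Prop. 2 (p. 100) and its proof.
* [GortzWedhorn2023] U. Görtz, T. Wedhorn, *Algebraic Geometry II* (2023), Prop. 27.15, Rem. 27.18.
-/

noncomputable section

-- `TopCat.Presheaf`/`Scheme.Modules` are not reducible (as in Mathlib's `AlgebraicGeometry/Modules/Sheaf.lean`).
set_option backward.isDefEq.respectTransparency false

universe v u

open CategoryTheory CategoryTheory.Limits MonoidalCategory CartesianMonoidalCategory MonObj AlgebraicGeometry

namespace Literature.AlgebraicGeometry.GroupSchemes

/-! ## §1 Two biproduct decompositions with a common summand -/

section Biprod

variable {C : Type u} [Category.{v} C] [Preadditive C] [HasBinaryBiproducts C] {X Y Q W : C}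
  (a : X ⟶ W) (b : Y ⟶ W) (c : Q ⟶ W) [IsIso (biprod.desc a c)] [IsIso (biprod.desc b c)]

/-- The composite isomorphism `X ⊞ Q ≅ W ≅ Y ⊞ Q` of two biproduct decompositions of `W` with the same second
summand map `c`. [folklore] -/
def shearOfBiprodDesc : X ⊞ Q ≅ Y ⊞ Q := asIso (biprod.desc a c) ≪≫ (asIso (biprod.desc b c)).symm

/-- The composite `X ⊞ Q ≅ W ≅ Y ⊞ Q` fixes the second summand: `inr ≫ θ = inr`. [folklore] -/
@[reassoc]
private theorem inr_shearOfBiprodDesc_hom : biprod.inr ≫ (shearOfBiprodDesc a b c).hom = biprod.inr := by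
  rw [shearOfBiprodDesc, Iso.trans_hom, asIso_hom, Iso.symm_hom, biprod.inr_desc_assoc, Iso.comp_inv_eq,
    asIso_hom, biprod.inr_desc]

/-- … and so does its inverse: `inr ≫ θ⁻¹ = inr`. [folklore] -/
@[reassoc]
private theorem inr_shearOfBiprodDesc_inv : biprod.inr ≫ (shearOfBiprodDesc a b c).inv = biprod.inr := by
  rw [← Iso.cancel_iso_hom_right _ _ (shearOfBiprodDesc a b c), Category.assoc, Iso.inv_hom_id,
    Category.comp_id, inr_shearOfBiprodDesc_hom]

/-- The corner identity: for an isomorphism `θ : X ⊞ Q ≅ Y ⊞ Q` fixing `inr`, the corner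
`inl ≫ θ ≫ fst : X ⟶ Y` has right inverse `inl ≫ θ⁻¹ ≫ fst` (lower-triangular matrices). [folklore] -/
private theorem corner_comp_corner (θ : X ⊞ Q ≅ Y ⊞ Q) (h : biprod.inr ≫ θ.inv = biprod.inr) :
    (biprod.inl ≫ θ.hom ≫ biprod.fst) ≫ (biprod.inl ≫ θ.inv ≫ biprod.fst) = 𝟙 X := by
  have htot : ∀ {Z : C} (g : Y ⊞ Q ⟶ Z),
      biprod.fst ≫ biprod.inl ≫ g = g - biprod.snd ≫ biprod.inr ≫ g := fun g => by
    rw [eq_sub_iff_add_eq, ← Category.assoc, ← Category.assoc, ← Preadditive.add_comp, biprod.total,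
      Category.id_comp]
  simp only [Category.assoc]
  rw [htot, Preadditive.comp_sub, Preadditive.comp_sub, θ.hom_inv_id_assoc, biprod.inl_fst, reassoc_of% h,
    biprod.inr_fst, comp_zero, comp_zero, comp_zero, sub_zero]

/-- **Two biproduct decompositions `(a, c) : X ⊞ Q ≅ W`, `(b, c) : Y ⊞ Q ≅ W` with the same second component
identify the first summands: `X ≅ Y`.** (The composite `X ⊞ Q ≅ Y ⊞ Q` fixes `inr`, hence is lower triangular
with an invertible corner.) Used with `W = Ω¹_{G × G}`, `c = d pr₂`, `a = d m`, `b = d pr₁`: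
`m^*Ω¹_G ≅ pr₁^*Ω¹_G`. [cite: BoschLutkebohmertRaynaud1990, §4.2 Prop. 2 (proof: Ω¹_{G×G/G} = p₁^*Ω¹ and the G-automorphism (m, p₂))] -/
def isoOfIsIsoBiprodDesc : X ≅ Y where
  hom := biprod.inl ≫ (shearOfBiprodDesc a b c).hom ≫ biprod.fst
  inv := biprod.inl ≫ (shearOfBiprodDesc a b c).inv ≫ biprod.fst
  hom_inv_id := corner_comp_corner (shearOfBiprodDesc a b c) (inr_shearOfBiprodDesc_inv a b c)
  inv_hom_id := by
    simpa only [Iso.symm_hom, Iso.symm_inv] using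
      corner_comp_corner (shearOfBiprodDesc a b c).symm (inr_shearOfBiprodDesc_hom a b c)

end Biprod

/-! ## §2 The shear fan `(m, pr₂)` of a group object is a limit fan -/

section Shear

variable {C : Type u} [Category.{v} C] [CartesianMonoidalCategory C] (G : C) [GrpObj G]

/-- **The fan `(m, pr₂) : G ⊗ G ⟶ G, G` is a binary product fan** — it is the standard fan `(pr₁, pr₂)`
precomposed with the shear isomorphism `(m, pr₂)` (`GrpObjShear.isIso_lift_mul_snd`).
[cite: BoschLutkebohmertRaynaud1990, §4.2 (the universal translation is a T-automorphism of G_T, T = G)] -/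
def isLimit_shearFan : IsLimit (BinaryFan.mk μ[G] (snd G G)) := by
  haveI := isIso_lift_mul_snd G
  refine (tensorProductIsBinaryProduct G G).ofIsoLimit ((Cone.ext (asIso (lift μ[G] (snd G G))) ?_).symm)
  rintro ⟨⟨⟩⟩
  · exact (lift_fst _ _).symm
  · exact (lift_snd _ _).symm

end Shear

/-! ## §3 `M ≅ π^* e^* M` from `m^* M ≅ pr₁^* M` -/

section Unit

variable {k : Type u} [CommRing k] (G : Over (Spec (CommRingCat.of k))) [GrpObj G]

/-- The section `s = (1, id) : G ⟶ G ⊗ G`, `x ↦ (e, x)`, of the second projection. [folklore] -/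
def unitIdSection : G ⟶ G ⊗ G := lift (1 : G ⟶ G) (𝟙 G)

/-- `s ≫ m = 𝟙`: `e · x = x`. [cite: BoschLutkebohmertRaynaud1990, §4.2 Prop. 2 (proof: the section (ε ∘ p, id) of p₂ with m ∘ (ε p, id) = id)] -/
@[reassoc]
theorem unitIdSection_mul : unitIdSection G ≫ μ[G] = 𝟙 G := by
  rw [unitIdSection, ← Hom.mul_def, _root_.one_mul]

/-- `s ≫ pr₁ = 1` (the constant map `G → Spec k → G` at the unit). [cite: BoschLutkebohmertRaynaud1990, §4.2 Prop. 2 (proof: p₁ ∘ (ε p, id) = ε ∘ p)] -/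
@[reassoc]
theorem unitIdSection_fst : unitIdSection G ≫ fst G G = 1 := lift_fst _ _

/-- `s ≫ pr₂ = 𝟙`. [cite: BoschLutkebohmertRaynaud1990, §4.2 Prop. 2 (proof: (ε p, id) is a section of p₂)] -/
@[reassoc]
theorem unitIdSection_snd : unitIdSection G ≫ snd G G = 𝟙 G := lift_snd _ _

/-- On underlying schemes the constant map `1 : G ⟶ G` is `G → Spec k → G`, structure map followed by the unit
section. [folklore] -/
private theorem one_left : (1 : G ⟶ G).left = G.hom ≫ η[G].left := rfl

/-- On underlying schemes `(s ≫ pr₁) = π ≫ e`. [cite: BoschLutkebohmertRaynaud1990, §4.2 Prop. 2 (proof: p₁ ∘ (ε p, id) = ε ∘ p)] -/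
theorem unitIdSection_fst_left : (unitIdSection G).left ≫ (fst G G).left = G.hom ≫ η[G].left := by
  rw [← Over.comp_left, unitIdSection_fst]; rfl

/-- On underlying schemes `(s ≫ m) = 𝟙`. [cite: BoschLutkebohmertRaynaud1990, §4.2 Prop. 2 (proof: m ∘ (ε p, id) = id)] -/
theorem unitIdSection_mul_left : (unitIdSection G).left ≫ μ[G].left = 𝟙 G.left := by
  rw [← Over.comp_left, unitIdSection_mul]; rfl

/-- **BLR §4.2 Prop. 2, the formal skeleton: a module `M` on a group scheme `G/k` with `m^*M ≅ pr₁^*M` on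
`G × G` is pulled back from its restriction to the unit section, `M ≅ π^* e^* M`.** The isomorphism is
`M ≅ (s ≫ m)^*M ≅ s^* m^* M ≅ s^* pr₁^* M ≅ (s ≫ pr₁)^*M = (π ≫ e)^*M ≅ π^* e^* M` for `s = (1, id)`.
[cite: BoschLutkebohmertRaynaud1990, §4.2 Prop. 2] -/
def pullbackIsoPullbackUnitOfShear (M : G.left.Modules)
    (ψ : (Scheme.Modules.pullback μ[G].left).obj M ≅ (Scheme.Modules.pullback (fst G G).left).obj M) :
    M ≅ (Scheme.Modules.pullback G.hom).obj ((Scheme.Modules.pullback η[G].left).obj M) :=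
  (Scheme.Modules.pullbackId G.left).symm.app M ≪≫
    (Scheme.Modules.pullbackCongr (unitIdSection_mul_left G).symm).app M ≪≫
      ((Scheme.Modules.pullbackComp (unitIdSection G).left μ[G].left).app M).symm ≪≫
        (Scheme.Modules.pullback (unitIdSection G).left).mapIso ψ ≪≫
          (Scheme.Modules.pullbackComp (unitIdSection G).left (fst G G).left).app M ≪≫
            (Scheme.Modules.pullbackCongr (unitIdSection_fst_left G)).app M ≪≫
              ((Scheme.Modules.pullbackComp G.hom η[G].left).app M).symm

/-- **BLR §4.2 Prop. 2 (skeleton), `Nonempty` form consumed by the assembly of `Ω¹_A ≅ 𝒪_A^{dim A}`**: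
`m^*M ≅ pr₁^*M ⟹ M ≅ π^* e^* M`. [cite: BoschLutkebohmertRaynaud1990, §4.2 Prop. 2] -/
theorem nonempty_iso_pullback_pullback_unit (M : G.left.Modules)
    (ψ : (Scheme.Modules.pullback μ[G].left).obj M ≅ (Scheme.Modules.pullback (fst G G).left).obj M) :
    Nonempty (M ≅ (Scheme.Modules.pullback G.hom).obj ((Scheme.Modules.pullback η[G].left).obj M)) :=
  ⟨pullbackIsoPullbackUnitOfShear G M ψ⟩

end Unit

end Literature.AlgebraicGeometry.GroupSchemes

end
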